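import Literature.NumberTheory.AdelicBaseChange.PadicTensorCompletionProofs
import Mathlib.RingTheory.Trace.Basic
import Mathlib.LinearAlgebra.StdBasis
import HarnessLib

/-!
# The semi-local algebra `ℚ_p ⊗_ℚ L ≅ ∏_{w ∣ p} L_w`, II: the trace is the sum of the local traces

`Proofs` file (theorems only, no definitions, no named facts) in topic
`NumberTheory/AdelicBaseChange`; continuation of `PadicTensorCompletionProofs` (the `ℚ`-algebra
isomorphism `Ψ : ℚ_[p] ⊗[ℚ] L ≃ₐ[ℚ] ∏_{w ∣ v_p} L_w` with `Ψ(s ⊗ x)_w = x · e_p(s)`,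
`e_p = Padic.adicCompletionEquiv : ℚ_[p] ≃ ℚ_{v_p}`, Cassels–Fröhlich II §10 (10.2) at `K = ℚ`).

* `trace_pi_apply` — the trace of a finite product of finite free algebras is the sum of the
  traces of the components (block-diagonal left-multiplication matrix in the product basis);
* `padicTensor_trace` — **`e_p (Tr_{(ℚ_p ⊗ L)/ℚ_p} x) = Σ_{w ∣ v_p} Tr_{L_w/ℚ_{v_p}} (Ψ x)_w`** for
  every `ℚ`-algebra isomorphism `Ψ` with the pure-tensor formula: the semi-local trace functional of
  the elliptic-curve consumers (`Algebra.trace ℚ_[p] (ℚ_[p] ⊗[ℚ] ℚ(ζ_m))` in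
  `KimAtThreePortSharedSATCore` / `KimAtThreeFineKatoRiderAssembly`) is the sum of the local traces
  (Mathlib `Algebra.trace_eq_of_equiv_equiv` along `(e_p, Ψ)`, then the product formula).

## References

* [CasselsFrohlichANT1967] J. W. S. Cassels, A. Fröhlich (eds.), *Algebraic Number Theory* (1967),
  Ch. II §10, Theorem (10.2) and §11 (local traces and norms: `Tr_{L/K} = Σ_w Tr_{L_w/K_v}` on
  `L ⊗_K K_v`).

## Design

No definitions; `Ψ` quantified with its pure-tensor formula as in part I.  `noncomputable section`;
axioms standard.
-/

noncomputable section

open scoped TensorProduct NumberField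
open IsDedekindDomain NumberField

namespace Literature.NumberTheory.AdelicBaseChange

/-- **Trace of a finite product of algebras**: for finite free `R`-algebras `A i` over a finite index
type, `Tr_{(∏ A_i)/R}(y) = Σ_i Tr_{A_i/R}(y_i)` (the left-multiplication matrix in the product basis
`Pi.basis` is block diagonal). [cite: CasselsFrohlichANT1967, Ch. II §11 (Tr_{L/K} = Σ_w Tr_{L_w/K_v})] -/
theorem trace_pi_apply {R : Type*} [CommRing R] {ι : Type*} [Fintype ι] [DecidableEq ι]
    {A : ι → Type*} [∀ i, CommRing (A i)] [∀ i, Algebra R (A i)] [∀ i, Module.Free R (A i)]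
    [∀ i, Module.Finite R (A i)] (y : Π i, A i) :
    Algebra.trace R (Π i, A i) y = ∑ i, Algebra.trace R (A i) (y i) := by
  classical
  let b : ∀ i, Module.Basis (Module.Free.ChooseBasisIndex R (A i)) R (A i) :=
    fun i ↦ Module.Free.chooseBasis R (A i)
  rw [Algebra.trace_eq_matrix_trace (Pi.basis b) y, Matrix.trace]
  simp_rw [Algebra.trace_eq_matrix_trace (b _), Matrix.trace, Matrix.diag]
  rw [← Finset.univ_sigma_univ, Finset.sum_sigma]
  refine Finset.sum_congr rfl fun i _ ↦ Finset.sum_congr rfl fun k _ ↦ ?_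
  rw [Algebra.leftMulMatrix_eq_repr_mul, Algebra.leftMulMatrix_eq_repr_mul, Pi.basis_repr,
    Pi.basis_apply]
  change (b i).repr ((y * Pi.single i (b i k)) i) k = (b i).repr (y i * b i k) k
  rw [Pi.mul_apply, Pi.single_eq_same]

variable {L : Type} [Field L] [NumberField L] {p : ℕ} [Fact p.Prime]

/-- **The semi-local trace is the sum of the local traces**: for a `ℚ`-algebra isomorphism
`Ψ : ℚ_[p] ⊗[ℚ] L ≃ₐ[ℚ] ∏_{w ∣ v_p} L_w` with `Ψ(s ⊗ x)_w = x · e_p(s)` (part I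
`exists_padicTensorAlgEquiv`), `e_p (Tr_{(ℚ_p ⊗_ℚ L)/ℚ_p}(x)) = Σ_w Tr_{L_w/ℚ_{v_p}}((Ψ x)_w)`
(transport of the trace along the `e_p`-semilinear isomorphism, Mathlib `Algebra.trace_eq_of_equiv_equiv`,
then `trace_pi_apply`; the `Fintype` instance on the primes above `p` is the packet's
`IsDedekindDomain.HeightOneSpectrum.Extension.fintype (𝓞 ℚ) ℚ L (𝓞 L) v_p`). [cite: CasselsFrohlichANT1967, Ch. II §10 Theorem (10.2) and §11] -/
theorem padicTensor_trace
    [Fintype (((Rat.HeightOneSpectrum.primesEquiv (R := 𝓞 ℚ)).symm ⟨p, Fact.out⟩).Extension (𝓞 L))]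
    (Ψ : ℚ_[p] ⊗[ℚ] L ≃ₐ[ℚ]
      (Π w : ((Rat.HeightOneSpectrum.primesEquiv (R := 𝓞 ℚ)).symm ⟨p, Fact.out⟩).Extension (𝓞 L),
        w.1.adicCompletion L))
    (hΨ : ∀ (s : ℚ_[p]) (x : L)
      (w : ((Rat.HeightOneSpectrum.primesEquiv (R := 𝓞 ℚ)).symm ⟨p, Fact.out⟩).Extension (𝓞 L)),
      Ψ (s ⊗ₜ[ℚ] x) w = algebraMap L (w.1.adicCompletion L) x *
        algebraMap (((Rat.HeightOneSpectrum.primesEquiv (R := 𝓞 ℚ)).symm ⟨p, Fact.out⟩).adicCompletion ℚ)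
          (w.1.adicCompletion L) (Padic.adicCompletionEquiv (𝓞 ℚ) ⟨p, Fact.out⟩ s))
    (x : ℚ_[p] ⊗[ℚ] L) :
    Padic.adicCompletionEquiv (𝓞 ℚ) ⟨p, Fact.out⟩ (Algebra.trace ℚ_[p] (ℚ_[p] ⊗[ℚ] L) x) =
      ∑ w : ((Rat.HeightOneSpectrum.primesEquiv (R := 𝓞 ℚ)).symm ⟨p, Fact.out⟩).Extension (𝓞 L),
        Algebra.trace (((Rat.HeightOneSpectrum.primesEquiv (R := 𝓞 ℚ)).symm ⟨p, Fact.out⟩).adicCompletion ℚ)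
          (w.1.adicCompletion L) (Ψ x w) := by
  classical
  have he : RingHom.comp
      (algebraMap (((Rat.HeightOneSpectrum.primesEquiv (R := 𝓞 ℚ)).symm ⟨p, Fact.out⟩).adicCompletion ℚ)
        (Π w : ((Rat.HeightOneSpectrum.primesEquiv (R := 𝓞 ℚ)).symm ⟨p, Fact.out⟩).Extension (𝓞 L), w.1.adicCompletion L))
      ((Padic.adicCompletionEquiv (𝓞 ℚ) ⟨p, Fact.out⟩).toRingEquiv :
        ℚ_[p] →+* ((Rat.HeightOneSpectrum.primesEquiv (R := 𝓞 ℚ)).symm ⟨p, Fact.out⟩).adicCompletion ℚ) =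
      RingHom.comp (Ψ.toRingEquiv : ℚ_[p] ⊗[ℚ] L →+* _) (algebraMap ℚ_[p] (ℚ_[p] ⊗[ℚ] L)) := by
    refine RingHom.ext fun s ↦ funext fun w ↦ ?_
    change algebraMap (((Rat.HeightOneSpectrum.primesEquiv (R := 𝓞 ℚ)).symm ⟨p, Fact.out⟩).adicCompletion ℚ) (w.1.adicCompletion L)
        (Padic.adicCompletionEquiv (𝓞 ℚ) ⟨p, Fact.out⟩ s) = Ψ (s ⊗ₜ[ℚ] (1 : L)) w
    rw [hΨ, map_one, one_mul]
  have h := Algebra.trace_eq_of_equiv_equiv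
    ((Padic.adicCompletionEquiv (𝓞 ℚ) ⟨p, Fact.out⟩).toRingEquiv) Ψ.toRingEquiv he x
  rw [h]
  change (Padic.adicCompletionEquiv (𝓞 ℚ) ⟨p, Fact.out⟩).toRingEquiv
      ((Padic.adicCompletionEquiv (𝓞 ℚ) ⟨p, Fact.out⟩).toRingEquiv.symm _) = _
  rw [RingEquiv.apply_symm_apply, ← trace_pi_apply]
  rfl

end Literature.NumberTheory.AdelicBaseChange

end
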